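import Literature.AnabelianGeometry.EtaleTheta.Discharge.Sec2Prop214iiiBiInversionOfModel
import Literature.AnabelianGeometry.EtaleTheta.SettingModelChiInversionTheta

/-!
# [EtTh] Prop 2.14 (iii), BI-theta `{±1}`-part: the COCYCLE-level inversion datum is INHABITED at the
# χ-twisted root model, and the bi lift there (proof-only companion; non-vacuity evidence)

Mochizuki, *The Étale Theta Function and its Frobenioid-theoretic Manifestations* [EtTh], Publ. RIMS 45
(2009), §2, Prop 2.14 (iii) p.50, Prop 1.4 (ii) p.22, Prop 2.2 (i) p.37 (locators `p.N` = PDF pages of the PRIMS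
text; bib key `MochizukiEtTh2009`). PROOF-ONLY companion (no `def`; seat abc-iut-L2-t2, §2 owner) of
`Discharge/Sec2Prop214iiiBiInversionOfModel.lean` (`rigidData_exists_biIso_over_conjInversion`, hypothesis
`hιF : ∃ F a, [F] = η̈^Θ ∧ a ∈ l·Δ_Θ ∧ γ^Θ ∘ F ∘ ι⁻¹ = F·∂a`) at abc-iut-L2-d1's χ-twisted root model
(`SettingModelChiInversionTheta.lean`, p440780: the twisted inversion `ι` of `Π^tp_X = Γ ⋊_χ G_{ℚ_p}` fixes the
model's theta COCYCLE on the nose, `transportFun_thetaCocycleχ_twistedInversion`).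

* `hιF_modelχ` — the cocycle-level datum HOLDS at the χ-model with `F :=` the model cocycle of `η̈^Θ`
  (`etaDdχ_eq_mk`) and `a := 1`: the hypothesis shape of the bi `{±1}`-part is inhabited (it is not an
  artefact of the typing).
* `exists_biIso_over_conjInversion_modelχ` — hence at `C := doubleUnderlineχSec p l hl`
  (abc-iut-L2-d1, abc-iut-L2-t6: the χ-model with ITS OWN class as `η̈^Θ`) every mod-`N` theta cocycle `η` admits
  `σ ∈ Π^tp_X̲̲` and an automorphism of the model bi-theta environment `B_N(η)` inducing the `σ`-conjugated
  twisted inversion on `Π^tp_Y̲̲` — ALL `E`-free binders of the bi `{±1}`-part discharged BY NAME from p440780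
  (`thm16i_…`, `map_Huu_…`, `exists_restrict_…`, `mem_GtpY_iff_…`, `aug_eq_one_iff_…`, `thetaIso_…_eq_self`);
  the remaining hypotheses are `hC`, `hS`, a cyclotome `μ`, cusp labels `L` and `h15 : Prop15iii` (abc-iut-L2-t12:
  expected-false at this stage-1 model — so this instance is CONSISTENCY EVIDENCE for the binder shapes, not a
  discharge at genuine data; unlike the mono case no Cor 2.18 (ii) input occurs).
HONEST FRAMING: semi-synthetic model = consistency evidence only; [EtTh] is refereed; no side is taken on
[IUTchIII] Cor 3.12; typed ≠ discharged elsewhere.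
-/

noncomputable section

namespace Literature.AnabelianGeometry.EtaleTheta.SettingModel

open Literature.AnabelianGeometry.SemiGraphs

variable (p : ℕ) [Fact p.Prime]

/-- **The cocycle-level inversion datum `hιF` HOLDS at the χ-model** with `a = 1`: the model cocycle `F` of
`η̈^Θ` (`etaDdχ_eq_mk`) satisfies `ι^Θ ∘ F ∘ ι⁻¹ = F = F · ∂1` for the twisted inversion (abc-iut-L2-d1's
`transportFun_thetaCocycleχ_twistedInversion`). [cite: MochizukiEtTh2009, Prop 1.4 (ii) p.22] -/
theorem hιF_modelχ (l : ℕ) :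
    ∃ (F : ↥(ThetaSetting.modelχ p).GtpYdd → ↥(ThetaSetting.modelχ p).DeltaTheta)
      (hF : F ∈ contCocycles (ThetaSetting.modelχ p).toTheta (ThetaSetting.modelχ p).DeltaTheta
        (ThetaSetting.modelχ p).GtpYdd)
      (a : ↥(ThetaSetting.modelχ p).DeltaTheta),
      ContH1.mk F hF = etaDdχ p ∧
        (a : (ThetaSetting.modelχ p).GtpTheta) ∈ (ThetaSetting.modelχ p).lDeltaTheta l ∧
        ThetaSetting.transportFun
            ((ThetaSetting.modelχ p).thetaCompanionOfAut (twistedInversionTop (chi p) (isInducing_leftRightχ p))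
              (map_deltaTemp_twistedInversion_modelχ p) (isQuotientMap_toTheta_modelχ p))
            (thm16i_twistedInversion_modelχ p) F =
          fun g => F g * (MulAut.conjNormal ((ThetaSetting.modelχ p).toTheta (g : PiTpχ p)) a * a⁻¹) := by
  refine ⟨_, _, 1, (etaDdχ_eq_mk p).symm, one_mem _, ?_⟩
  rw [transportFun_thetaCocycleχ_twistedInversion]
  funext g
  rw [map_one, inv_one, mul_one, mul_one]

/-- **[EtTh] Prop 2.14 (iii), BI `{±1}`-part, at the χ-model with its own class as `η̈^Θ`** (`C := doubleUnderlineχSec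
p l hl`): for every mod-`N` theta cocycle `η` there are `σ ∈ Π^tp_X̲̲` and an automorphism of the model bi-theta
environment `B_N(η)` inducing `y ↦ σ·ι(σ⁻¹ y σ)·σ⁻¹` on `Π^tp_Y̲̲`, `ι` the twisted inversion — every `E`-free binder
of `rigidData_exists_biIso_over_conjInversion` supplied BY NAME from abc-iut-L2-d1's p440780 and `hιF_modelχ`;
residual hypotheses `hC`, `hS`, `μ`, `L`, `h15 : Prop15iii` (expected-false at this stage-1 model: consistency
evidence for the binder shapes only). [cite: MochizukiEtTh2009, Prop 2.14(iii) p.50] -/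
theorem exists_biIso_over_conjInversion_modelχ (l : ℕ+) (hl : Odd (l : ℕ))
    (hC : (ThetaSetting.modelχ p).Compat) (hS : (ThetaSetting.modelχ p).Sec2Hyps)
    (h15 : ThetaSetting.Prop15iii (etaleThetaDataχSec p (etaDdχ p)) hC)
    (L : (doubleUnderlineχSec p l hl).CuspLabels) {N : ℕ+}
    (μ : (ThetaSetting.modelχ p).CyclotomeMod (l : ℕ) N)
    {η : ↥((ThetaSetting.modelχ p).GtpYdd.subgroupOf (doubleUnderlineχSec p l hl).Huu) → MuN p N}
    (hη : η ∈ (doubleUnderlineχSec p l hl).thetaCocycles hC μ) :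
    ∃ (σ : (doubleUnderlineχSec p l hl).Huu)
      (α : (((doubleUnderlineχSec p l hl).rigidData μ hC hS h15 L).modelBi hη).Iso
        (((doubleUnderlineχSec p l hl).rigidData μ hC hS h15 L).modelBi hη)),
      ∀ x, (((CycEnvelope.proj ((doubleUnderlineχSec p l hl).rigidData μ hC hS h15 L).augY
            ((doubleUnderlineχSec p l hl).rigidData μ hC hS h15 L).chi (α.e x) :
          ((doubleUnderlineχSec p l hl).rigidData μ hC hS h15 L).PiY) : (doubleUnderlineχSec p l hl).Huu) :
            PiTpχ p) =
        σ * twistedInversionTop (chi p) (isInducing_leftRightχ p)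
          ((σ : PiTpχ p)⁻¹ * ((CycEnvelope.proj ((doubleUnderlineχSec p l hl).rigidData μ hC hS h15 L).augY
            ((doubleUnderlineχSec p l hl).rigidData μ hC hS h15 L).chi x :
              ((doubleUnderlineχSec p l hl).rigidData μ hC hS h15 L).PiY) : (doubleUnderlineχSec p l hl).Huu) * σ) *
          (σ : PiTpχ p)⁻¹ := by
  obtain ⟨φ, hφ⟩ := exists_restrict_twistedInversion_Huuχ p l
  exact (doubleUnderlineχSec p l hl).rigidData_exists_biIso_over_conjInversion μ
    (twistedInversionTop (chi p) (isInducing_leftRightχ p))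
    ((ThetaSetting.modelχ p).thetaCompanionOfAut (twistedInversionTop (chi p) (isInducing_leftRightχ p))
      (map_deltaTemp_twistedInversion_modelχ p) (isQuotientMap_toTheta_modelχ p))
    (thm16i_twistedInversion_modelχ p) (map_Huu_doubleUnderlineχSec_twistedInversion p l hl) φ hφ hC hS h15 L
    (mem_GtpY_iff_twistedInversion_modelχ p) (aug_eq_one_iff_twistedInversion_modelχ p)
    (thetaIso_thetaCompanionOfAut_twistedInversion_eq_self p) (hιF_modelχ p l) hη

end Literature.AnabelianGeometry.EtaleTheta.SettingModel

end
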